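import Literature.AlgebraicGeometry.Morphisms.CechModuleH2RefinementLemmas
import HarnessLib

/-!
# Refinement of Čech `2`-cochains commutes with a morphism of modules; class-level bookkeeping
# «two cochains that differ by a coboundary have the same componentwise classes»

Sequel of `Morphisms/CechModuleH2Refinement(Lemmas)` (the refinement map `cechMRefineC2` along `τ : 𝒲 → 𝒰`,
`W_j ⊆ U_{τ j}`, a map of complexes in degree `2`; [GortzWedhorn2023] (21.16), Def. 21.71) and `CechModuleH2` (`Ž²`, `B̌²`,
`Ȟ² = Ž²/B̌²`, functoriality `cechMapC2` / `cechMapH2` in the sheaf of modules; [StacksProject, Tag 01ED]).  THEOREMS ONLY.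

* `cechMapC2_refineC2` — **`φ(ρ e) = ρ(φ e)`**: refinement commutes with a morphism `φ : M ⟶ N` of `𝒪_X`-modules
  (both are «restrict, then apply `φ`» entrywise; `MSections.res_app`);
* `CechMH2.mk_mapC2_eq_mk_mapC2_of_sub_mem_cechMB2` — if two `2`-cocycles `e₁, e₂` of `M` on `𝒲` differ by a coboundary,
  their images under `φ` have the same class in `Ȟ²(𝒲, N)`;
* **`CechMH2.mk_mapC2_eq_mk_refineC2_mapC2_of_sub_refineC2_mem_cechMB2`** — the COMPONENTWISE form of «a cochain `o′` on
  the refinement `𝒲` that differs from the refined cochain `ρ o` by a coboundary has the same classes»: for cocycles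
  `o` on `𝒰` and `o′` on `𝒲` with `o′ − ρ o ∈ B̌²(𝒲, M)` and every `φ : M ⟶ N`,
  `[φ o′] = [ρ (φ o)]` in `Ȟ²(𝒲, N)` — the shape of the «cover-independence» relation rel₂ of the componentwise Čech criterion
  `Morphisms/CechModuleH2ScalingVanishing` (`π_a = φ`), fed by the deformation-theoretic identity «the obstruction
  cochain of the restricted lifts differs from the refined obstruction cochain by a coboundary».

Cell hodgecm-mathlib (D-0151), F-11 α1 / J4-(iv) slot (4) rel₂, bookkeeping half (B-p16 (g19) under F0P1a-p04); generic,
count-neutral.  HC_CM is proved only modulo the 7 printed citations until rung 0 closes — nothing here bears on it.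

## References
* [GortzWedhorn2023] U. Görtz, T. Wedhorn, *Algebraic Geometry II* (2023), (21.16), Def. 21.71 (p. 262).
* [StacksProject] The Stacks Project, Tag 01ED (the Čech complex is functorial in the sheaf).
-/

noncomputable section

open CategoryTheory AlgebraicGeometry Limits TopologicalSpace Opposite

universe u v w

namespace Literature.AlgebraicGeometry.Morphisms

variable {A : Type u} [CommRing A] {X : Scheme.{u}} (f : X ⟶ Spec (.of A)) {M N : X.Modules} (φ : M ⟶ N)
  {ι : Type v} {ι' : Type w} (U : ι → X.Opens) (V : ι' → X.Opens) (τ : ι' → ι) (hτ : ∀ j, V j ≤ U (τ j))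

/-- **Refinement commutes with a morphism of modules**: `φ(ρ e) = ρ(φ e)` on `2`-cochains.
[cite: GortzWedhorn2023, (21.16) Def. 21.71 (p. 181)] [cite: StacksProject, Tag 01ED (Cohomology, Section 20.9)] -/
theorem cechMapC2_refineC2 (e : CechMC2 f M U) :
    cechMapC2 f φ V (cechMRefineC2 f M U V τ hτ e) = cechMRefineC2 f N U V τ hτ (cechMapC2 f φ U e) := by
  funext j j' j''
  rw [cechMapC2_apply, cechMRefineC2_apply, cechMRefineC2_apply, cechMapC2_apply, MSections.res_app]

/-- Refinement commutes with a morphism of modules on `1`-cochains. [cite: GortzWedhorn2023, (21.16) Def. 21.71 (p. 181)] -/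
theorem cechMapC1_refineC1 (c : CechMC1 f M U) :
    cechMapC1 f φ V (cechMRefineC1 f M U V τ hτ c) = cechMRefineC1 f N U V τ hτ (cechMapC1 f φ U c) := by
  funext j j'
  rw [cechMapC1_apply, cechMRefineC1_apply, cechMRefineC1_apply, cechMapC1_apply, MSections.res_app]

/-- **Cocycles that differ by a coboundary have the same image classes**: for `2`-cocycles `e₁, e₂` of `M` on `𝒱` with
`e₁ − e₂ ∈ B̌²(𝒱, M)` and `φ : M ⟶ N`, `[φ e₁] = [φ e₂]` in `Ȟ²(𝒱, N)`.
[cite: StacksProject, Tag 01ED (Cohomology, Section 20.9)] -/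
theorem CechMH2.mk_mapC2_eq_mk_mapC2_of_sub_mem_cechMB2 {e₁ e₂ : CechMC2 f M V} (he₁ : e₁ ∈ cechMZ2 f M V)
    (he₂ : e₂ ∈ cechMZ2 f M V) (h : e₁ - e₂ ∈ cechMB2 f M V) :
    CechMH2.mk f N V ⟨cechMapC2 f φ V e₁, mapC2_mem_cechMZ2 f φ V he₁⟩ =
      CechMH2.mk f N V ⟨cechMapC2 f φ V e₂, mapC2_mem_cechMZ2 f φ V he₂⟩ := by
  rw [CechMH2.mk_eq_mk_iff]
  have h' := mapC2_mem_cechMB2 f φ V h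
  rwa [map_sub] at h'

/-- **Componentwise cover independence from a coboundary identity.**  Let `o` be a `2`-cocycle of `M` on `𝒰` and `o′` a
`2`-cocycle of `M` on a refinement `𝒱` (`τ`, `V_j ⊆ U_{τ j}`) with `o′ − ρ o ∈ B̌²(𝒱, M)`.  Then for every morphism
`φ : M ⟶ N`, `[φ o′] = [ρ (φ o)]` in `Ȟ²(𝒱, N)` — the relation «rel₂» of the componentwise criterion
`CechModuleH2ScalingVanishing.mem_cechMB2_of_componentwise_scaling_relations` at `φ = π_a`.
[cite: GortzWedhorn2023, (21.16) Def. 21.71 (p. 181)] [cite: StacksProject, Tag 01ED (Cohomology, Section 20.9)] -/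
theorem CechMH2.mk_mapC2_eq_mk_refineC2_mapC2_of_sub_refineC2_mem_cechMB2 {o : CechMC2 f M U}
    (ho : o ∈ cechMZ2 f M U) {o' : CechMC2 f M V} (ho' : o' ∈ cechMZ2 f M V)
    (h : o' - cechMRefineC2 f M U V τ hτ o ∈ cechMB2 f M V) :
    CechMH2.mk f N V ⟨cechMapC2 f φ V o', mapC2_mem_cechMZ2 f φ V ho'⟩ =
      CechMH2.mk f N V ⟨cechMRefineC2 f N U V τ hτ (cechMapC2 f φ U o),
        refineMC2_mem_cechMZ2 f N U V τ hτ (mapC2_mem_cechMZ2 f φ U ho)⟩ := by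
  rw [CechMH2.mk_eq_mk_iff]
  have h' := mapC2_mem_cechMB2 f φ V h
  rw [map_sub, cechMapC2_refineC2] at h'
  exact h'

/-- The same with the coboundary given explicitly: `o′ − ρ o = d¹ α`.
[cite: GortzWedhorn2023, (21.16) Def. 21.71 (p. 181)] [cite: StacksProject, Tag 01ED (Cohomology, Section 20.9)] -/
theorem CechMH2.mk_mapC2_eq_mk_refineC2_mapC2_of_sub_refineC2_eq_cechMD1 {o : CechMC2 f M U}
    (ho : o ∈ cechMZ2 f M U) {o' : CechMC2 f M V} (ho' : o' ∈ cechMZ2 f M V) (α : CechMC1 f M V)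
    (h : o' - cechMRefineC2 f M U V τ hτ o = cechMD1 f M V α) :
    CechMH2.mk f N V ⟨cechMapC2 f φ V o', mapC2_mem_cechMZ2 f φ V ho'⟩ =
      CechMH2.mk f N V ⟨cechMRefineC2 f N U V τ hτ (cechMapC2 f φ U o),
        refineMC2_mem_cechMZ2 f N U V τ hτ (mapC2_mem_cechMZ2 f φ U ho)⟩ :=
  CechMH2.mk_mapC2_eq_mk_refineC2_mapC2_of_sub_refineC2_mem_cechMB2 f φ U V τ hτ ho ho'
    ((mem_cechMB2_iff f M V _).mpr ⟨α, h.symm⟩)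

/-- Symmetric form: `ρ o − o′ = d¹ α`. [cite: GortzWedhorn2023, (21.16) Def. 21.71 (p. 181)]
[cite: StacksProject, Tag 01ED (Cohomology, Section 20.9)] -/
theorem CechMH2.mk_mapC2_eq_mk_refineC2_mapC2_of_refineC2_sub_eq_cechMD1 {o : CechMC2 f M U}
    (ho : o ∈ cechMZ2 f M U) {o' : CechMC2 f M V} (ho' : o' ∈ cechMZ2 f M V) (α : CechMC1 f M V)
    (h : cechMRefineC2 f M U V τ hτ o - o' = cechMD1 f M V α) :
    CechMH2.mk f N V ⟨cechMapC2 f φ V o', mapC2_mem_cechMZ2 f φ V ho'⟩ =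
      CechMH2.mk f N V ⟨cechMRefineC2 f N U V τ hτ (cechMapC2 f φ U o),
        refineMC2_mem_cechMZ2 f N U V τ hτ (mapC2_mem_cechMZ2 f φ U ho)⟩ :=
  CechMH2.mk_mapC2_eq_mk_refineC2_mapC2_of_sub_refineC2_eq_cechMD1 f φ U V τ hτ ho ho' (-α)
    (by rw [map_neg, ← h, neg_sub])


/-! ## Edition 2: two covers refined into one (the shape of «cover independence» between `𝒰` and `𝒰′`) -/

section TwoCovers

variable {ι₂ : Type*} (U₂ : ι₂ → X.Opens) (τ₂ : ι' → ι₂) (hτ₂ : ∀ j, V j ≤ U₂ (τ₂ j))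

/-- **Two cocycles on two covers whose refinements to a common cover differ by a coboundary have the same componentwise
refined classes**: for cocycles `o` on `𝒰`, `o₂` on `𝒰₂`, refinement maps `τ`, `τ₂` into one family `𝒱`, and
`ρ_{τ₂} o₂ − ρ_τ o ∈ B̌²(𝒱, M)`, every `φ : M ⟶ N` gives `[ρ_{τ₂}(φ o₂)] = [ρ_τ(φ o)]` in `Ȟ²(𝒱, N)` — the relation rel₂ of
`Morphisms/CechModuleH2ScalingVanishing` with `q := ρ_{τ₂}(φ o₂)` (componentwise class of a second cochain on a second cover,
e.g. the obstruction cochain of the same deformation datum on the preimage cover `f⁻¹𝒰`).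
[cite: GortzWedhorn2023, (21.16) Def. 21.71 (p. 181)] [cite: StacksProject, Tag 01ED (Cohomology, Section 20.9)] -/
theorem CechMH2.mk_refineC2_mapC2_eq_of_refineC2_sub_refineC2_mem_cechMB2 {o : CechMC2 f M U}
    (ho : o ∈ cechMZ2 f M U) {o₂ : CechMC2 f M U₂} (ho₂ : o₂ ∈ cechMZ2 f M U₂)
    (h : cechMRefineC2 f M U₂ V τ₂ hτ₂ o₂ - cechMRefineC2 f M U V τ hτ o ∈ cechMB2 f M V) :
    CechMH2.mk f N V ⟨cechMRefineC2 f N U₂ V τ₂ hτ₂ (cechMapC2 f φ U₂ o₂),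
        refineMC2_mem_cechMZ2 f N U₂ V τ₂ hτ₂ (mapC2_mem_cechMZ2 f φ U₂ ho₂)⟩ =
      CechMH2.mk f N V ⟨cechMRefineC2 f N U V τ hτ (cechMapC2 f φ U o),
        refineMC2_mem_cechMZ2 f N U V τ hτ (mapC2_mem_cechMZ2 f φ U ho)⟩ := by
  have h1 := CechMH2.mk_mapC2_eq_mk_refineC2_mapC2_of_sub_refineC2_mem_cechMB2 f φ U V τ hτ ho
    (refineMC2_mem_cechMZ2 f M U₂ V τ₂ hτ₂ ho₂) h
  rw [← h1]
  congr 1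
  exact Subtype.ext (cechMapC2_refineC2 f φ U₂ V τ₂ hτ₂ o₂).symm

/-- The same with an explicit coboundary `ρ_{τ₂} o₂ − ρ_τ o = d¹ α`.
[cite: GortzWedhorn2023, (21.16) Def. 21.71 (p. 181)] [cite: StacksProject, Tag 01ED (Cohomology, Section 20.9)] -/
theorem CechMH2.mk_refineC2_mapC2_eq_of_refineC2_sub_refineC2_eq_cechMD1 {o : CechMC2 f M U}
    (ho : o ∈ cechMZ2 f M U) {o₂ : CechMC2 f M U₂} (ho₂ : o₂ ∈ cechMZ2 f M U₂) (α : CechMC1 f M V)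
    (h : cechMRefineC2 f M U₂ V τ₂ hτ₂ o₂ - cechMRefineC2 f M U V τ hτ o = cechMD1 f M V α) :
    CechMH2.mk f N V ⟨cechMRefineC2 f N U₂ V τ₂ hτ₂ (cechMapC2 f φ U₂ o₂),
        refineMC2_mem_cechMZ2 f N U₂ V τ₂ hτ₂ (mapC2_mem_cechMZ2 f φ U₂ ho₂)⟩ =
      CechMH2.mk f N V ⟨cechMRefineC2 f N U V τ hτ (cechMapC2 f φ U o),
        refineMC2_mem_cechMZ2 f N U V τ hτ (mapC2_mem_cechMZ2 f φ U ho)⟩ :=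
  CechMH2.mk_refineC2_mapC2_eq_of_refineC2_sub_refineC2_mem_cechMB2 f φ U V τ hτ U₂ τ₂ hτ₂ ho ho₂
    ((mem_cechMB2_iff f M V _).mpr ⟨α, h.symm⟩)

/-- Orientation `ρ_τ o − ρ_{τ₂} o₂ = d¹ α`. [cite: GortzWedhorn2023, (21.16) Def. 21.71 (p. 181)]
[cite: StacksProject, Tag 01ED (Cohomology, Section 20.9)] -/
theorem CechMH2.mk_refineC2_mapC2_eq_of_refineC2_sub_refineC2_eq_cechMD1' {o : CechMC2 f M U}
    (ho : o ∈ cechMZ2 f M U) {o₂ : CechMC2 f M U₂} (ho₂ : o₂ ∈ cechMZ2 f M U₂) (α : CechMC1 f M V)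
    (h : cechMRefineC2 f M U V τ hτ o - cechMRefineC2 f M U₂ V τ₂ hτ₂ o₂ = cechMD1 f M V α) :
    CechMH2.mk f N V ⟨cechMRefineC2 f N U₂ V τ₂ hτ₂ (cechMapC2 f φ U₂ o₂),
        refineMC2_mem_cechMZ2 f N U₂ V τ₂ hτ₂ (mapC2_mem_cechMZ2 f φ U₂ ho₂)⟩ =
      CechMH2.mk f N V ⟨cechMRefineC2 f N U V τ hτ (cechMapC2 f φ U o),
        refineMC2_mem_cechMZ2 f N U V τ hτ (mapC2_mem_cechMZ2 f φ U ho)⟩ :=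
  CechMH2.mk_refineC2_mapC2_eq_of_refineC2_sub_refineC2_eq_cechMD1 f φ U V τ hτ U₂ τ₂ hτ₂ ho ho₂ (-α)
    (by rw [map_neg, ← h, neg_sub])

end TwoCovers

end Literature.AlgebraicGeometry.Morphisms

end
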